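import Literature.MathematicalPhysics.QuantumFieldTheory.Balaban1983to89.B5Hk103ScalarZd
import Literature.MathematicalPhysics.QuantumFieldTheory.Balaban1983to89.Beta.PoissonInterior

/-!
# `BalabanUV.Beta.D1BFx.BlockColumnPoisson` — road «BF-x» for binder row D1, sub-leaf **A3.a-P** (part 1 of 3):
# the POISSON EQUATION and the BLOCK `ℓ¹` MASS of a block column `u = (G′Q′*)(·,y′) = G′1_{B(y′)}` of the B4-Sect.5
# whole-lattice kernel (`B5Hk103ScalarZd.gq`) on `ℤ^d`, plus the block geometry the interior estimate needs

HONEST FRAMING (cell contract, verbatim): «discharging `BetaPertH` makes Bałaban's UV stability UNCONDITIONAL — a real constructive-QFT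
result; it is NOT the continuum limit and NOT the Clay problem.»  HONEST DEPENDENCY (verbatim): «continuum YM on T⁴ ⇐ BetaPertH ∧ nine
spine estimates (0/9 proved); BetaPertH ⇐ (D1) ∧ (D4) ∧ CAP+tail; G-an2-4 gates asym, D1 and NE2/3/4.»  THIS MODULE DISCHARGES NOTHING of
that: [folklore] lattice bookkeeping feeding an elementary elliptic-regularity estimate (`D1BFx/BlockColumnSupNorm`) for ONE leg of ONE term
class (A0 census row τ5 of road BF-x) of ONE conjunct (D1).  0 wall binders instantiated; NOT A3.a, NOT D1, NOT BetaPertH, NOT continuum,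
NOT Clay.  ABSOLUTE RULE (cell, verbatim): «No internally-minted statement may enter as a cited fact. Every hypothesis is either
kernel-proved in this package or a verbatim quotation of a PUBLISHED theorem with page reference.»  Nothing printed is asserted or cited
below; every theorem is proved outright from the tree modules `B5Hk103ScalarZd` (pv23-g7), `B6QGQDecay237`/`B6QGQLower276` (pv23),
`Beta/PoissonInterior` (pv23-g4; only its `cube`) and Mathlib; no definition at all.

WHY (skeleton `HOME/beta/skeletons/D1-b2b-balaban-beta-d1-p2.md` node A3; `HOME/b2b-balaban-beta-d1-p2/A0-TERM-CENSUS.md` v1 row τ5 and SIZES «`P` …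
rank-one-per-block projector, kernel `|P(x,y)| ≲ n^{−4}`, smooth at scale n»; leaf-07 gen-2 HANDOFF «INFO for A3.a»).  The sharp projector bound
needs a MESH-FREE sup-norm bound on the block columns `(G′Q′*)(·,y′)`; the tree's `B5Hk103ScalarZd.abs_gq_le` pays `(n+1)^{d/2}` (an `ℓ²`
Combes–Thomas bound read at a point).  The repair is pv23-g4's discrete interior estimate `PoissonInterior.interior_estimate` (the route of
pv23-g4's TORUS module `TransportLeg.block_legs`, here on `ℤ^d`), whose two inputs this file supplies:
(A) **the Poisson equation of a column** — from the pointwise identity `A(G′Q′*) = Q′*` (`B5Hk103ScalarZd.sum_AX_mul_gq`,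
    `A = (n+1)²(−Δ) + a(n+1)^{−d}1[same block]`): `Δu(p) = −(1[blk p = y′] − a·(Q′G′Q′*)(blk p, y′))/(n+1)²` (`lap_gq`), whence with the
    MESH-FREE coarse bound `B6QGQDecay237.abs_kerQGQ_le_unif`: `|Δu(p)| ≤ (1[blk p = y′] + a c_u e^{−δ_u|blk p − y′|_∞})/(n+1)²` (`abs_lap_gq_le`)
    — the unit-lattice Laplacian of a column is `O(η²)`, exponentially small away from the source block;
(B) **the block `ℓ¹` mass** `Σ_{p∈B(y″)}|u(p)| ≤ c_u (n+1)^d e^{−δ_u|y″−y′|_∞}` (`sum_abs_gq_le`: pv23-g7's `abs_sum_mul_gq_le` tested against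
    the sign pattern of the column — Cauchy–Schwarz built in).
CONTENT.  §1 block geometry [folklore]: integer division is 1-Lipschitz at the block scale (`abs_ediv_sub_ediv_le_one`), adjacent blocks
(`dist_blk_le_one`, `dist_blk_add_e_le_one`, `dist_blk_sub_e_le_one`), cubes of radius `≤ n+1` sit in the `3^d` blocks adjacent to the block
of their centre (`dist_blk_le_one_of_mem_cube`, `cube_subset_U`), `card_cube`.  §2 (A): `lap_eq_neg_tsum_lapKer` (lit1's
`latticeLaplacianZd` = minus the row action of pv23's `lapKer`), `tsum_lap_mul_gq`, `lap_gq`, `abs_lap_gq_le`.  §3 (B): `sum_abs_gq_le`.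
HONEST SCOPE: scalar, `U = 1`, whole lattice `ℤ^d`, any `d`, any mesh `n`, `a > 0`; nothing here is an estimate on `u` itself.
-/

namespace Summit.QuantumFields.BalabanUV.Beta.D1BFx.BlockColumnPoisson

open Finset Real
open Literature.MathematicalPhysics.QuantumFieldTheory.Balaban1983to89
open Literature.Probability.LatticeModels (latticeLaplacianZd latticeLaplacianZd_def)
open B4Sect5Proof (latticeConst latticeConst_nonneg)
open B6QGQLower276 (X e blk B mem_B B_disjoint U mem_U sum_U sum_B_const side side_facts lapKer sameBlk AX kerQGQ)
open B6QGQDecay237 (cU deltaU cU_pos deltaU_pos deltaU_le_one abs_kerQGQ_le_unif cInv deltaInv cInv_pos deltaInv_pos)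
open B5Hk103ScalarZd (Gk gq Kinv kerH abs_gq_le abs_sum_mul_gq_le sum_AX_mul_gq tsum_AX_mul tsum_lapKer_mul nbhd
  lapKer_eq_zero_of_not_mem summable_expX tsum_expX_le exp_split_triangle abs_Kinv_le summable_kerH deltaH deltaH_pos)
open Beta.PoissonInterior (cube mem_cube interior_estimate)

noncomputable section

variable {d : ℕ}

/-! ## §1 Block geometry: adjacent blocks, cubes of radius `≤ n+1` -/

/-- [folklore] Integer division by `s > 0` is `1`-Lipschitz at scale `s`: `|u − v| ≤ s ⇒ |u/s − v/s| ≤ 1`. -/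
theorem abs_ediv_sub_ediv_le_one {s u v : ℤ} (hs : 0 < s) (h : |u - v| ≤ s) : |u / s - v / s| ≤ 1 := by
  rw [abs_le] at h ⊢
  obtain ⟨h1, h2⟩ := h
  have hs0 : s ≠ 0 := hs.ne'
  constructor
  · have hle : v - s ≤ u := by linarith
    have hm := Int.ediv_le_ediv hs hle
    have e1 : (v - s) / s = v / s - 1 := by
      rw [show v - s = v + (-1) * s by ring, Int.add_mul_ediv_right _ _ hs0]; ring
    linarith
  · have hle : u ≤ v + s := by linarith
    have hm := Int.ediv_le_ediv hs hle
    have e1 : (v + s) / s = v / s + 1 := by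
      rw [show v + s = v + 1 * s by ring, Int.add_mul_ediv_right _ _ hs0]
    linarith

/-- [folklore] Two fine sites within `n+1` of each other in every coordinate lie in ADJACENT blocks:
`dist (blk n z) (blk n x) ≤ 1` (sup metric on the block lattice). -/
theorem dist_blk_le_one {n : ℕ} {z x : X d} (h : ∀ i, |z i - x i| ≤ (n : ℤ) + 1) : dist (blk n z) (blk n x) ≤ 1 := by
  refine (dist_pi_le_iff zero_le_one).2 fun i => ?_
  rw [Int.dist_eq]
  have hi : |blk n z i - blk n x i| ≤ 1 := abs_ediv_sub_ediv_le_one (side_facts n).1 (h i)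
  have : |((blk n z i : ℤ) : ℝ) - ((blk n x i : ℤ) : ℝ)| ≤ 1 := by exact_mod_cast hi
  exact this

/-- [folklore] One lattice step moves the block index by at most one: `dist (blk n (p + e_μ)) (blk n p) ≤ 1`. -/
theorem dist_blk_add_e_le_one (n : ℕ) (p : X d) (μ : Fin d) : dist (blk n (p + e μ)) (blk n p) ≤ 1 := by
  refine dist_blk_le_one fun i => ?_
  by_cases hi : i = μ
  · subst hi; simp [e]
  · simp [e, hi]; positivity

/-- [folklore] The same for the backward step: `dist (blk n (p − e_μ)) (blk n p) ≤ 1`. -/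
theorem dist_blk_sub_e_le_one (n : ℕ) (p : X d) (μ : Fin d) : dist (blk n (p - e μ)) (blk n p) ≤ 1 := by
  refine dist_blk_le_one fun i => ?_
  by_cases hi : i = μ
  · subst hi; simp [e]
  · simp [e, hi]; positivity

/-- [folklore] A point of a cube of radius `R ≤ n+1` about `x` lies in a block adjacent to `blk x`. -/
theorem dist_blk_le_one_of_mem_cube {n R : ℕ} (hR : R ≤ n + 1) {x z : X d} (hz : z ∈ cube x R) :
    dist (blk n z) (blk n x) ≤ 1 := by
  rw [mem_cube] at hz
  refine dist_blk_le_one fun i => (hz i).trans ?_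
  exact_mod_cast hR

/-- [folklore] Points of the unit cube of the block lattice are at block distance `≤ 1` from its centre. -/
theorem dist_le_one_of_mem_cube_one {c y : X d} (hy : y ∈ cube c 1) : dist c y ≤ 1 := by
  rw [mem_cube] at hy
  refine (dist_pi_le_iff zero_le_one).2 fun i => ?_
  rw [Int.dist_eq, abs_sub_comm]
  have : |((y i : ℤ) : ℝ) - ((c i : ℤ) : ℝ)| ≤ 1 := by exact_mod_cast hy i
  exact this

/-- [folklore] The covering of a cube of radius `R ≤ n+1` by the `3^d` blocks adjacent to the block of its centre:
`cube x R ⊆ ⋃_{y″ ∈ cube (blk x) 1} B(y″)`. -/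
theorem cube_subset_U {n R : ℕ} (hR : R ≤ n + 1) (x : X d) : cube x R ⊆ U n (cube (blk n x) 1) := by
  intro z hz
  rw [mem_U, mem_cube]
  intro i
  have h := dist_blk_le_one_of_mem_cube (n := n) hR hz
  have hi : dist (blk n z i) (blk n x i) ≤ 1 := (dist_le_pi_dist _ _ i).trans h
  rw [Int.dist_eq] at hi
  have : ((|blk n z i - blk n x i| : ℤ) : ℝ) ≤ 1 := by push_cast; exact hi
  exact_mod_cast this

/-- [folklore] The number of sites of a cube of radius `R` in `ℤ^d` is `(2R+1)^d`. -/
theorem card_cube (c : X d) (R : ℕ) : (cube c R).card = (2 * R + 1) ^ d := by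
  unfold cube
  rw [Fintype.card_piFinset]
  have h : ∀ i, (Finset.Icc (c i - R) (c i + R)).card = 2 * R + 1 := fun i => by
    rw [Int.card_Icc, show c i + (R : ℤ) + 1 - (c i - R) = ((2 * R + 1 : ℕ) : ℤ) by push_cast; ring, Int.toNat_natCast]
  simp [h, Finset.prod_const]

/-! ## §2 The Poisson equation of a block column `u = (G′Q′*)(·, y′)` -/

/-- [folklore] lit1's graph Laplacian is minus the row action of the positive Laplacian kernel `lapKer`:
`Δu(p) = −Σ'_r (−Δ)(p,r) u(r)`. -/
theorem lap_eq_neg_tsum_lapKer (u : X d → ℝ) (p : X d) :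
    latticeLaplacianZd u p = -(∑' r : X d, lapKer p r * u r) := by
  rw [tsum_lapKer_mul, latticeLaplacianZd_def]
  simp only [e, Finset.sum_sub_distrib, Finset.sum_const, Finset.card_univ, Fintype.card_fin, nsmul_eq_mul,
    Finset.sum_add_distrib]
  ring

/-- [folklore] **`Δ^η(G′Q′*) = Q′* − aQ′*(Q′G′Q′*)`, entrywise**: `Σ'_r (n+1)²(−Δ)(p,r)(G′Q′*)(r,y′) = 1[blk p = y′] − a·(Q′G′Q′*)(blk p, y′)`
(split of the site matrix `A = (n+1)²(−Δ) + a(n+1)^{−d}1[same block]` in `A(G′Q′*) = Q′*`). -/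
theorem tsum_lap_mul_gq (n : ℕ) {a : ℝ} (ha : 0 < a) (p y' : X d) :
    ∑' r : X d, (((n : ℝ) + 1) ^ 2 * lapKer p r) * gq n a r y'
      = (if blk n p = y' then 1 else 0) - a * kerQGQ n a (blk n p) y' := by
  classical
  have hEL : ∑' r : X d, AX n a p r * gq n a r y' = if blk n p = y' then 1 else 0 := by
    rw [tsum_AX_mul n a p, sum_AX_mul_gq n ha p y']
  have hsuppL : ∀ r ∉ nbhd n p, (((n : ℝ) + 1) ^ 2 * lapKer p r) * gq n a r y' = 0 := by
    intro r hr
    rw [lapKer_eq_zero_of_not_mem hr, mul_zero, zero_mul]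
  have hsuppB : ∀ r ∉ B n (blk n p), (a / ((n : ℝ) + 1) ^ d * sameBlk n p r) * gq n a r y' = 0 := by
    intro r hr
    have : sameBlk n p r = 0 := by
      rw [sameBlk, if_neg]
      exact fun h => hr (mem_B.2 h.symm)
    rw [this, mul_zero, zero_mul]
  have hsL : Summable fun r : X d => (((n : ℝ) + 1) ^ 2 * lapKer p r) * gq n a r y' :=
    summable_of_ne_finset_zero hsuppL
  have hsB : Summable fun r : X d => (a / ((n : ℝ) + 1) ^ d * sameBlk n p r) * gq n a r y' :=
    summable_of_ne_finset_zero hsuppB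
  have hsplit : ∑' r : X d, AX n a p r * gq n a r y'
      = ∑' r : X d, (((n : ℝ) + 1) ^ 2 * lapKer p r) * gq n a r y'
        + ∑' r : X d, (a / ((n : ℝ) + 1) ^ d * sameBlk n p r) * gq n a r y' := by
    rw [← hsL.tsum_add hsB]
    refine tsum_congr fun r => ?_
    rw [AX]; ring
  have hblock : ∑' r : X d, (a / ((n : ℝ) + 1) ^ d * sameBlk n p r) * gq n a r y'
      = a * kerQGQ n a (blk n p) y' := by
    -- `(Q′G′Q′*)(y,y′) = (n+1)^{−d} Σ_{p∈B(y)} (G′Q′*)(p,y′)` by `rfl` (pv23-g11's `B6QGQFourier275Zd.kerQGQ_eq_sum_gq`, not imported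
    -- here to keep the import cone light)
    rw [tsum_eq_sum (s := B n (blk n p)) hsuppB,
      show kerQGQ n a (blk n p) y' = (((n : ℝ) + 1) ^ d)⁻¹ * ∑ r ∈ B n (blk n p), gq n a r y' from rfl,
      Finset.mul_sum, Finset.mul_sum]
    refine Finset.sum_congr rfl fun r hr => ?_
    have : sameBlk n p r = 1 := by
      rw [sameBlk, if_pos (mem_B.1 hr).symm]
    rw [this, div_eq_mul_inv]; ring
  rw [hsplit, hblock] at hEL
  linarith

/-- [folklore] **THE POISSON EQUATION OF A BLOCK COLUMN**: `Δ(G′Q′* e_{y′})(p) = −(1[blk p = y′] − a(Q′G′Q′*)(blk p,y′))/(n+1)²`. -/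
theorem lap_gq (n : ℕ) {a : ℝ} (ha : 0 < a) (p y' : X d) :
    latticeLaplacianZd (fun r => gq n a r y') p
      = -(((if blk n p = y' then 1 else 0) - a * kerQGQ n a (blk n p) y') / ((n : ℝ) + 1) ^ 2) := by
  have hn : (0 : ℝ) < ((n : ℝ) + 1) ^ 2 := by positivity
  rw [lap_eq_neg_tsum_lapKer, ← tsum_lap_mul_gq n ha p y', neg_inj, eq_div_iff hn.ne', ← tsum_mul_right]
  refine tsum_congr fun r => ?_
  ring

/-- [folklore] **The unit-lattice Laplacian of a block column is `O(η²)`, exponentially small away from the source block**: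
`|Δ(G′Q′* e_{y′})(p)| ≤ (1[blk p = y′] + a·c_u·e^{−δ_u|blk p − y′|_∞})/(n+1)²` (mesh-free coarse bound `abs_kerQGQ_le_unif`). -/
theorem abs_lap_gq_le (n : ℕ) {a : ℝ} (ha : 0 < a) (p y' : X d) :
    |latticeLaplacianZd (fun r => gq n a r y') p|
      ≤ ((if blk n p = y' then 1 else 0) + a * cU d a * Real.exp (-(deltaU d a * dist (blk n p) y'))) / ((n : ℝ) + 1) ^ 2 := by
  have hn : (0 : ℝ) < ((n : ℝ) + 1) ^ 2 := by positivity
  rw [lap_gq n ha p y', abs_neg, abs_div, abs_of_pos hn]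
  refine div_le_div_of_nonneg_right ((abs_sub _ _).trans ?_) hn.le
  have h1 : |(if blk n p = y' then (1 : ℝ) else 0)| = if blk n p = y' then (1 : ℝ) else 0 := by
    split_ifs <;> simp
  have h2 : |a * kerQGQ n a (blk n p) y'| ≤ a * cU d a * Real.exp (-(deltaU d a * dist (blk n p) y')) := by
    rw [abs_mul, abs_of_pos ha, mul_assoc]
    exact mul_le_mul_of_nonneg_left (abs_kerQGQ_le_unif n ha (blk n p) y') ha.le
  rw [h1]; linarith

/-! ## §3 The block `ℓ¹` mass of a column -/

/-- [folklore] **Block `ℓ¹` mass**: `Σ_{p∈B(y″)} |(G′Q′*)(p,y′)| ≤ c_u (n+1)^d e^{−δ_u|y″ − y′|_∞}` (the `ℓ²` Combes–Thomas bound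
`abs_sum_mul_gq_le` tested against the sign pattern of the column, Cauchy–Schwarz built in). -/
theorem sum_abs_gq_le (n : ℕ) {a : ℝ} (ha : 0 < a) (y'' y' : X d) :
    ∑ p ∈ B n y'', |gq n a p y'| ≤ cU d a * ((n : ℝ) + 1) ^ d * Real.exp (-(deltaU d a * dist y'' y')) := by
  classical
  set v : X d → ℝ := fun p => if 0 ≤ gq n a p y' then 1 else -1 with hv
  have h := abs_sum_mul_gq_le n ha y'' y' v
  have hL : ∑ p ∈ B n y'', v p * gq n a p y' = ∑ p ∈ B n y'', |gq n a p y'| := by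
    refine Finset.sum_congr rfl fun p _ => ?_
    simp only [hv]
    split_ifs with hp
    · rw [one_mul, abs_of_nonneg hp]
    · rw [abs_of_neg (not_le.mp hp)]; ring
  have hR : ∑ p ∈ B n y'', v p ^ 2 = ((n : ℝ) + 1) ^ d := by
    have : ∀ p ∈ B n y'', v p ^ 2 = 1 := fun p _ => by simp only [hv]; split_ifs <;> norm_num
    rw [Finset.sum_congr rfl this, sum_B_const, mul_one]
  have hnn : (0 : ℝ) ≤ ((n : ℝ) + 1) ^ d := by positivity
  rw [hL, hR, abs_of_nonneg (Finset.sum_nonneg fun p _ => abs_nonneg _), mul_assoc, Real.mul_self_sqrt hnn] at h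
  linarith

end

end Summit.QuantumFields.BalabanUV.Beta.D1BFx.BlockColumnPoisson
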